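import Summits.CriticalPhenomena.PercolationContinuityZ3.Theorems.PercNearOneGluingNoHeavyLowerTailQuantitativeHarrisTwoAtomFloor
import HarnessLib

/-!
# The SHARP explicit strictness of Harris' inequality
# (`Cov(f,g) ≥ J_e(f)·J_e(g)·Π_{i∈E} w_i(1−w_i)`, hence `≥ (p₀(1−p₀))^{|E|}·J₁J₂`; equality for AND / OR at every weight vector)

Support file (`--supports stmt-CriticalPhenomena-4575`), prover seat `prim-rate-mine-2` (lane prim-rate, constants-miner (c), BENCH row
M2-R48; `run/shared/lean/prim/prim-rate/prim-rate-mine-2/PROOFS.md` §P48).  No definitions, no named facts, no sorries; standard axioms.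

From the two-atom floor `QuantHarris.cov_ge_twoAtom` (previous file):
* `QuantHarris.cov_ge_jumps_mul_prod` (cube): `(Π_i q_i(1−q_i)) · D_e f(η₁) · D_e g(η₂) ≤ E(fg) − E f·E g` — every `m_i ≥ q_i(1−q_i)`;
  ATTAINED by `f = AND`, `g = OR` at every weight vector (`QuantHarris.cov_and_or_eq_prod`), so the constant is final;
* `QuantHarris.cov_ge_twoAtom_prodBernoulli`, `QuantHarris.cov_ge_jumps_mul_prod_prodBernoulli` — the same for the tree's product measure
  `prodBernoulli w` on `Set ι` and monotone `f, g : Set ι → ℝ` (jumps `f(η ∪ {e}) − f(η ∖ {e})`);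
* **`QuantHarris.cov_ge_prodPow_mul_jumps`** — the support form SUPERSEDING row M2-R47 (`cov_ge_pow_mul_jumps`, exponent `2|E|+2`):
  `w = 0` off `E`, `p₀ ≤ w ≤ 1 − p₀` on `E`, `e ∈ E`, `η₁, η₂ ⊆ E`, `f, g` monotone nonnegative:
  **`(p₀(1−p₀))^{|E|} · (f(η₁ ∪ e) − f(η₁ ∖ e)) · (g(η₂ ∪ e) − g(η₂ ∖ e)) ≤ ∫ fg dμ − ∫ f dμ·∫ g dμ`**; the exponent `|E|` cannot be lowered
  (AND/OR on `E` at weights `p₀`: `Cov = (p₀(1−p₀))^{|E|}` with unit jumps).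
Consequence for the lane: every isolated Harris term of the explicit (S5)/(GEN) floors (rows M2-R21/30/41/45) is `0` or
`≥ Π(1−w)·(p₀(1−p₀))^{|E_{T<a}|}·J` — the quantitative dichotomy of row M2-R47 with the sharp exponent.
In print: Talagrand (1996) and Keller–Mossel–Sen bound `Cov` below by `c·φ(Σ_i I_i(f)I_i(g))` with unnamed constants and a logarithmic `φ`;
an atom-level sharp constant is not stated there.
[cite: Harris1960, Lemma 4.1 (p. 16)] [cite: Talagrand1996, Thm. 1.1 (p. 244)] [cite: FortuinKasteleynGinibre1971, Prop. 1 (p. 91)]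
-/

noncomputable section

namespace Summit.CriticalPhenomena.PercolationContinuityZ3.Theorems

namespace QuantHarris

open Finset Literature.Combinatorics.Sahi2008 SahiSubsetChord SahiCoSingleton

section Cube

variable {ι : Type*} [Fintype ι] [DecidableEq ι]

/-- **Sharp explicit strictness, witness-free constant (cube form).**  `(Π_i q_i(1−q_i)) · D_e f(η₁) · D_e g(η₂) ≤ E(fg) − E f·E g`
for nonnegative monotone `f, g`, every `e, η₁, η₂` (every `m_i ≥ q_i(1−q_i)`).  With `p₀ ≤ q ≤ 1 − p₀` the constant is
`≥ (p₀(1−p₀))^{|ι|}` — exponent `|E|`, replacing the `2|E|+2` of `cov_ge_pow_mul_jumps`; attained by AND/OR.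
[cite: Harris1960, Lemma 4.1 (p. 16)] [cite: Talagrand1996, Thm. 1.1 (p. 244)] -/
theorem cov_ge_jumps_mul_prod {q : ι → ℝ} (hq : ∀ i, 0 ≤ q i ∧ q i ≤ 1) (f g : (ι → Bool) → ℝ)
    (hf0 : ∀ x, 0 ≤ f x) (hg0 : ∀ x, 0 ≤ g x) (hf : Monotone f) (hg : Monotone g) (e : ι) (η₁ η₂ : ι → Bool) :
    (∏ i, q i * (1 - q i)) * (pivDiff e f η₁ * pivDiff e g η₂)
      ≤ ex (prodWeight q) (f * g) - ex (prodWeight q) f * ex (prodWeight q) g := by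
  have h := cov_ge_twoAtom hq f g hf0 hg0 hf hg e η₁ η₂
  have hle : ∏ i ∈ (univ : Finset ι).erase e, q i * (1 - q i)
      ≤ ∏ i ∈ (univ : Finset ι).erase e, (if η₁ i = η₂ i then (if η₁ i then q i else 1 - q i) else q i * (1 - q i)) := by
    refine Finset.prod_le_prod (fun i _ => mul_nonneg (hq i).1 (sub_nonneg.2 (hq i).2)) fun i _ => ?_
    have h0 := (hq i).1
    have h1 := (hq i).2
    split_ifs
    · nlinarith
    · nlinarith
    · exact le_rfl
  have hJ : 0 ≤ pivDiff e f η₁ * pivDiff e g η₂ := mul_nonneg (pivDiff_nonneg hf e η₁) (pivDiff_nonneg hg e η₂)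
  have hK0 : 0 ≤ q e * (1 - q e) := mul_nonneg (hq e).1 (sub_nonneg.2 (hq e).2)
  rw [← Finset.mul_prod_erase univ (fun i => q i * (1 - q i)) (Finset.mem_univ e)]
  calc q e * (1 - q e) * (∏ i ∈ (univ : Finset ι).erase e, q i * (1 - q i)) * (pivDiff e f η₁ * pivDiff e g η₂)
      = q e * (1 - q e) * (pivDiff e f η₁ * pivDiff e g η₂) * ∏ i ∈ (univ : Finset ι).erase e, q i * (1 - q i) := by ring
    _ ≤ q e * (1 - q e) * (pivDiff e f η₁ * pivDiff e g η₂) *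
        ∏ i ∈ (univ : Finset ι).erase e, (if η₁ i = η₂ i then (if η₁ i then q i else 1 - q i) else q i * (1 - q i)) :=
        mul_le_mul_of_nonneg_left hle (mul_nonneg hK0 hJ)
    _ ≤ _ := h

end Cube

/-! ### The product measure `prodBernoulli w` on `Set ι` -/

section ProdBernoulli

open MeasureTheory Set Literature.Probability.LatticeModels
open scoped Classical

variable {ι : Type*} [Fintype ι]

/-- **The two-atom floor for the product measure.**  For nonnegative monotone `f, g : Set ι → ℝ`, every coordinate `e` and ANY two
configurations `η₁, η₂`:
`w_e(1−w_e) · (f(η₁ ∪ {e}) − f(η₁ ∖ {e})) · (g(η₂ ∪ {e}) − g(η₂ ∖ {e})) · Π_{i ≠ e} m_i ≤ ∫ fg dμ − ∫ f dμ·∫ g dμ`, `μ = prodBernoulli w`,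
`m_i = w_i` (`i ∈ η₁ ∩ η₂`), `1 − w_i` (`i ∉ η₁ ∪ η₂`), `w_i(1−w_i)` (`i ∈ η₁ Δ η₂`).
[cite: Harris1960, Lemma 4.1 (p. 16)] [cite: Talagrand1996, Thm. 1.1 (p. 244)] -/
theorem cov_ge_twoAtom_prodBernoulli (w : ι → unitInterval) (f g : Set ι → ℝ)
    (hf0 : ∀ ω, 0 ≤ f ω) (hg0 : ∀ ω, 0 ≤ g ω) (hf : Monotone f) (hg : Monotone g) (e : ι) (η₁ η₂ : Set ι) :
    (w e : ℝ) * (1 - w e) * ((f (insert e η₁) - f (η₁ \ {e})) * (g (insert e η₂) - g (η₂ \ {e}))) *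
        ∏ i ∈ (Finset.univ : Finset ι).erase e,
          (if (i ∈ η₁ ↔ i ∈ η₂) then (if i ∈ η₁ then (w i : ℝ) else 1 - w i) else (w i : ℝ) * (1 - w i))
      ≤ ∫ ω, f ω * g ω ∂(prodBernoulli w) - (∫ ω, f ω ∂(prodBernoulli w)) * ∫ ω, g ω ∂(prodBernoulli w) := by
  have hq : ∀ i, 0 ≤ (w i : ℝ) ∧ (w i : ℝ) ≤ 1 := fun i => ⟨(w i).2.1, (w i).2.2⟩
  have h := cov_ge_twoAtom hq (fun x => f {i | x i = true}) (fun x => g {i | x i = true})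
    (fun _ => hf0 _) (fun _ => hg0 _) (monotone_comp_setOf hf) (monotone_comp_setOf hg) e η₁.boolIndicator η₂.boolIndicator
  rw [ex_prodWeight_eq_integral, ex_prodWeight_eq_integral, ex_prodWeight_eq_integral] at h
  simp only [Pi.mul_apply, pivDiff, setOf_update_true, setOf_update_false, setOf_boolIndicator] at h
  have hprod : ∏ i ∈ (Finset.univ : Finset ι).erase e,
        (if η₁.boolIndicator i = η₂.boolIndicator i then (if η₁.boolIndicator i = true then (w i : ℝ) else 1 - w i)
          else (w i : ℝ) * (1 - w i))
      = ∏ i ∈ (Finset.univ : Finset ι).erase e,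
          (if (i ∈ η₁ ↔ i ∈ η₂) then (if i ∈ η₁ then (w i : ℝ) else 1 - w i) else (w i : ℝ) * (1 - w i)) := by
    refine Finset.prod_congr rfl fun i _ => ?_
    by_cases h1 : i ∈ η₁ <;> by_cases h2 : i ∈ η₂ <;> simp [Set.boolIndicator, h1, h2]
  rw [hprod] at h
  exact h

/-- **Sharp explicit strictness, witness-free constant, for the product measure**: for nonnegative monotone `f, g : Set ι → ℝ` and every
`e, η₁, η₂`: `(Π_i w_i(1−w_i)) · (f(η₁ ∪ {e}) − f(η₁ ∖ {e})) · (g(η₂ ∪ {e}) − g(η₂ ∖ {e})) ≤ ∫ fg dμ − ∫ f dμ·∫ g dμ`.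
[cite: Harris1960, Lemma 4.1 (p. 16)] [cite: Talagrand1996, Thm. 1.1 (p. 244)] -/
theorem cov_ge_jumps_mul_prod_prodBernoulli (w : ι → unitInterval) (f g : Set ι → ℝ)
    (hf0 : ∀ ω, 0 ≤ f ω) (hg0 : ∀ ω, 0 ≤ g ω) (hf : Monotone f) (hg : Monotone g) (e : ι) (η₁ η₂ : Set ι) :
    (∏ i, (w i : ℝ) * (1 - w i)) * ((f (insert e η₁) - f (η₁ \ {e})) * (g (insert e η₂) - g (η₂ \ {e})))
      ≤ ∫ ω, f ω * g ω ∂(prodBernoulli w) - (∫ ω, f ω ∂(prodBernoulli w)) * ∫ ω, g ω ∂(prodBernoulli w) := by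
  have hq : ∀ i, 0 ≤ (w i : ℝ) ∧ (w i : ℝ) ≤ 1 := fun i => ⟨(w i).2.1, (w i).2.2⟩
  have h := cov_ge_jumps_mul_prod hq (fun x => f {i | x i = true}) (fun x => g {i | x i = true})
    (fun _ => hf0 _) (fun _ => hg0 _) (monotone_comp_setOf hf) (monotone_comp_setOf hg) e η₁.boolIndicator η₂.boolIndicator
  rw [ex_prodWeight_eq_integral, ex_prodWeight_eq_integral, ex_prodWeight_eq_integral] at h
  simp only [Pi.mul_apply, pivDiff, setOf_update_true, setOf_update_false, setOf_boolIndicator] at h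
  exact h

/-- **Sharp explicit strictness of Harris' inequality on a support (supersedes `cov_ge_pow_mul_jumps`).**  Weights `w = 0` off the finite
support `E`, `p₀ ≤ w ≤ 1 − p₀` on `E`; `f, g` monotone nonnegative; a coordinate `e ∈ E` with influence witnesses `η₁, η₂ ⊆ E`.  Then
`(p₀(1−p₀))^{|E|} · (f(η₁ ∪ e) − f(η₁ ∖ e)) · (g(η₂ ∪ e) − g(η₂ ∖ e)) ≤ ∫ fg dμ − ∫ f dμ · ∫ g dμ` — exponent `|E|` (row M2-R47 had
`p₀^{2|E|+2}`); the exponent is final (`cov_and_or_eq_prod`). [cite: Harris1960, Lemma 4.1 (p. 16)] [cite: Talagrand1996, Thm. 1.1 (p. 244)] -/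
theorem cov_ge_prodPow_mul_jumps (w : ι → unitInterval) (E : Finset ι) (p₀ : ℝ) (hp0 : 0 ≤ p₀)
    (hE0 : ∀ i, i ∉ E → (w i : ℝ) = 0) (hE1 : ∀ i ∈ E, p₀ ≤ (w i : ℝ) ∧ (w i : ℝ) ≤ 1 - p₀)
    (f g : Set ι → ℝ) (hf0 : ∀ ω, 0 ≤ f ω) (hg0 : ∀ ω, 0 ≤ g ω) (hf : Monotone f) (hg : Monotone g)
    (e : ι) (he : e ∈ E) (η₁ : Set ι) (hη₁ : η₁ ⊆ ↑E) (η₂ : Set ι) (hη₂ : η₂ ⊆ ↑E) :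
    (p₀ * (1 - p₀)) ^ E.card * ((f (insert e η₁) - f (η₁ \ {e})) * (g (insert e η₂) - g (η₂ \ {e}))) ≤
      ∫ ω, f ω * g ω ∂(prodBernoulli w) - (∫ ω, f ω ∂(prodBernoulli w)) * ∫ ω, g ω ∂(prodBernoulli w) := by
  have h := cov_ge_twoAtom_prodBernoulli w f g hf0 hg0 hf hg e η₁ η₂
  set M : ι → ℝ := fun i =>
    if (i ∈ η₁ ↔ i ∈ η₂) then (if i ∈ η₁ then (w i : ℝ) else 1 - w i) else (w i : ℝ) * (1 - w i) with hM
  set J : ℝ := (f (insert e η₁) - f (η₁ \ {e})) * (g (insert e η₂) - g (η₂ \ {e})) with hJ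
  have hJ0 : 0 ≤ J := mul_nonneg (sub_nonneg.2 (hf (fun x hx => Set.mem_insert_of_mem e hx.1)))
    (sub_nonneg.2 (hg (fun x hx => Set.mem_insert_of_mem e hx.1)))
  -- off `E` the factors are `1`
  have hsub : E.erase e ⊆ (Finset.univ : Finset ι).erase e := Finset.erase_subset_erase e (Finset.subset_univ E)
  have hprodE : ∏ i ∈ (Finset.univ : Finset ι).erase e, M i = ∏ i ∈ E.erase e, M i := by
    refine (Finset.prod_subset hsub fun i hi hiE => ?_).symm
    have hie : i ≠ e := (Finset.mem_erase.1 hi).1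
    have hiE' : i ∉ E := fun h' => hiE (Finset.mem_erase.2 ⟨hie, h'⟩)
    have h1 : i ∉ η₁ := fun h' => hiE' (Finset.mem_coe.1 (hη₁ h'))
    have h2 : i ∉ η₂ := fun h' => hiE' (Finset.mem_coe.1 (hη₂ h'))
    simp only [hM, h1, h2, hE0 i hiE', iff_self, if_true, if_false, sub_zero]
  -- on `E` every factor is at least `p₀(1−p₀)`
  have hp1 : p₀ ≤ 1 - p₀ := (hE1 e he).1.trans (hE1 e he).2
  have hc0 : 0 ≤ p₀ * (1 - p₀) := mul_nonneg hp0 (hp0.trans hp1)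
  have hcp : p₀ * (1 - p₀) ≤ p₀ := by nlinarith
  have hfac : ∀ i ∈ E.erase e, p₀ * (1 - p₀) ≤ M i := by
    intro i hi
    have hiE : i ∈ E := Finset.mem_of_mem_erase hi
    have lo := (hE1 i hiE).1
    have up := (hE1 i hiE).2
    simp only [hM]
    split_ifs
    · exact hcp.trans lo
    · linarith
    · nlinarith [mul_nonneg (sub_nonneg.2 lo) (sub_nonneg.2 up)]
  have hprod_ge : (p₀ * (1 - p₀)) ^ (E.erase e).card ≤ ∏ i ∈ E.erase e, M i := by
    rw [← Finset.prod_const]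
    exact Finset.prod_le_prod (fun _ _ => hc0) hfac
  have hwe : p₀ * (1 - p₀) ≤ (w e : ℝ) * (1 - w e) := by
    nlinarith [mul_nonneg (sub_nonneg.2 (hE1 e he).1) (sub_nonneg.2 (hE1 e he).2)]
  have hwe0 : 0 ≤ (w e : ℝ) * (1 - w e) := mul_nonneg (w e).2.1 (sub_nonneg.2 (w e).2.2)
  have hcard : E.card = (E.erase e).card + 1 := (Finset.card_erase_add_one he).symm
  rw [hprodE] at h
  calc (p₀ * (1 - p₀)) ^ E.card * J
      = (p₀ * (1 - p₀)) * (p₀ * (1 - p₀)) ^ (E.erase e).card * J := by rw [hcard, pow_succ]; ring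
    _ ≤ ((w e : ℝ) * (1 - w e)) * (∏ i ∈ E.erase e, M i) * J :=
        mul_le_mul_of_nonneg_right (mul_le_mul hwe hprod_ge (pow_nonneg hc0 _) hwe0) hJ0
    _ = (w e : ℝ) * (1 - w e) * J * ∏ i ∈ E.erase e, M i := by ring
    _ ≤ _ := h

end ProdBernoulli

end QuantHarris

end Summit.CriticalPhenomena.PercolationContinuityZ3.Theorems

end
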